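import Summits.Ventures.PercRepro.RankLevelSetCoreSixLowSelf

/-!
# PercRepro — THE `e`-FREE CORE AT LEVEL `6`, EVERY CORANK `≥ 52`, EVERY RANK `p ≥ 36` (p8 g3, S3)

`proofs/SUBCLAIM-S3-p8.md` §3n. RankLevelSetCoreSixLowSelf's device needs `n₀ ≥ 89` only through `n^6 ≤ 1100·C(n, 6)`,
which holds from `n ≥ 88` (`pow_six_le_choose_of_88'`); the subtracted-term key at `p = 36` holds at `n₀ = 88 = p + 52`
(`key_six_sub_36_88'`, decided): **`c025_core_six_thirtynine_thirtysix'`** = the cells `(p, d ≥ 52)` for every `p ≥ 36`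
(`p ≥ 37` by the parent module). Axioms: standard.
-/

open scoped Matroid

namespace PercRepro

namespace ThmN

open Set

variable {α : Type}

/-- `n^6 ≤ 1100·C(n, 6)` for `n ≥ 88` (`720·C(n, 6) = (n−5)(n−4)(n−3)(n−2)(n−1)n`; the polynomial
`1100·Π − 720·n^6` has positive coefficients in `t = n − 88`). -/
theorem pow_six_le_choose_of_88' (n : ℕ) (hn : 88 ≤ n) : n ^ 6 ≤ 1100 * n.choose 6 := by
  obtain ⟨t, rfl⟩ : ∃ t, n = 88 + t := ⟨n - 88, by omega⟩
  have h := choose_six_mul (82 + t)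
  have h6 : (88 + t).choose 6 = (82 + t + 6).choose 6 := by congr 1; ring
  have key : 720 * (88 + t) ^ 6 ≤ 1100 * ((82 + t + 1) * (82 + t + 2) * (82 + t + 3) * (82 + t + 4) *
      (82 + t + 5) * (82 + t + 6)) := by
    ring_nf
    nlinarith [Nat.zero_le t, Nat.zero_le (t ^ 2), Nat.zero_le (t ^ 3), Nat.zero_le (t ^ 4), Nat.zero_le (t ^ 5),
      Nat.zero_le (t ^ 6)]
  have : 720 * (88 + t) ^ 6 ≤ 720 * (1100 * (88 + t).choose 6) := by
    rw [h6, show 720 * (1100 * (82 + t + 6).choose 6) = 1100 * (720 * (82 + t + 6).choose 6) by ring, h]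
    exact key
  exact Nat.le_of_mul_le_mul_left this (by norm_num)

/-- **Regime II at level `6` with the rank-`≤ 6` sets subtracted from the `(p − 1)`-subsets**: for a rank-`p`
`e`-free core on `n ≥ n₀ ≥ 88` elements with the key
`(2^{p+6} + 7700·C(p+6, p))·2^{33}·C(n, 6) ≤ C(p+6, p)·C(n, p − 1)` for every `n ≥ n₀`, `RLS M p 6`
(`U ≤ C(n, 6)·2^{33}`, `Y ≥ C(n, p − 1) − 7700·2^{33}·C(n, 6)`, `Φ ≤ 2^{p+6}/C(p+6, p)`). -/
theorem core_six_corank_of_key_sub'' (n₀ : ℕ) (h88 : 88 ≤ n₀) (M : Matroid α) [M.Finite] (p : ℕ) (hp : 1 ≤ p)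
    (hkey : ∀ n, n₀ ≤ n → (2 ^ (p + 6) + 7700 * (p + 6).choose p) * 2 ^ 33 * n.choose 6 ≤
      (p + 6).choose p * n.choose (p - 1))
    (hbig : n₀ ≤ M.E.ncard)
    (hfree : ∀ e ∈ M.E, ∃ A ⊆ M.E \ {e}, e ∉ M.closure A ∧ e ∉ M.closure ((M.E \ {e}) \ A)) : RLS M p 6 := by
  classical
  set n := M.E.ncard with hn_def
  have hEcard : M.ground_finite.toFinset.card = n := by
    rw [hn_def, Set.ncard_eq_toFinset_card _ M.ground_finite]
  have hBj : ∀ j : ℕ, j ≤ 6 → ∀ X ⊆ M.E, M.eRk X ≤ j → X.ncard + 6 ≤ 39 + j := by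
    intro j hj X hX hr
    rcases Nat.lt_or_ge j 4 with h | h
    · have := ncard_add_one_le_two_pow_of_eRk_le M (not_isLoop_of_free M hfree) hfree j X hX hr
      interval_cases j <;> omega
    · rcases Nat.lt_or_ge j 5 with h5 | h5
      · have hj4 : j = 4 := by omega
        subst hj4
        have := ncard_le_ten_of_eRk_le_four_of_free M hfree hX hr
        omega
      · rcases Nat.lt_or_ge j 6 with h6 | h6
        · have hj5 : j = 5 := by omega
          subst hj5
          have := ncard_le_nineteen_of_eRk_le_five_of_free M hfree hX hr
          omega
        · have hj6 : j = 6 := by omega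
          subst hj6
          have := ncard_le_thirtynine_of_eRk_le_six_of_free M hfree hX hr
          omega
  have hBq' : ∀ X ⊆ M.E, M.eRk X ≤ 6 → X.ncard ≤ 39 := fun X hX hr => by
    have := hBj 6 le_rfl X hX hr; omega
  have hU : Matroid.topCount M p 6 ≤ n.choose 6 * 2 ^ (39 - 6) := by
    calc Matroid.topCount M p 6 ≤ Matroid.levelCount M 6 := Matroid.topCount_le_levelCount_bot p 6
      _ = {X : Set α | X ⊆ M.E ∧ M.eRk X = 6}.ncard := rfl
      _ ≤ n.choose 6 * 2 ^ (39 - 6) := by rw [← hEcard]; exact ncard_eRk_eq_le_choose_mul_of_bound M 6 39 hBq'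
  have hA := ncard_eRk_le_le_sum_choose_mul_of_bound M 6 39 hBj
  rw [hEcard] at hA
  have hsum := sum_choose_le_mul_pow n 6 (by omega)
  have hpow := pow_six_le_choose_of_88' n (by omega)
  have hA' : {X : Set α | X ⊆ M.E ∧ M.eRk X ≤ 6}.ncard ≤ 7700 * n.choose 6 * 2 ^ 33 := by
    calc {X : Set α | X ⊆ M.E ∧ M.eRk X ≤ 6}.ncard ≤ (∑ j ∈ Finset.range (6 + 1), n.choose j) * 2 ^ (39 - 6) := hA
      _ ≤ ((6 + 1) * n ^ 6) * 2 ^ (39 - 6) := Nat.mul_le_mul_right _ hsum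
      _ ≤ ((6 + 1) * (1100 * n.choose 6)) * 2 ^ (39 - 6) := by gcongr
      _ = 7700 * n.choose 6 * 2 ^ 33 := by ring
  have hY := choose_le_midCount_add_low' (M := M) (p := p) (q := 6) hp
  rw [hEcard] at hY
  have hkey := hkey n hbig
  have hΦ := phiK_le_two_pow_div p 6
  rw [RLS_iff]
  -- in `ℚ`
  have hc : (0 : ℚ) < ((p + 6).choose p : ℚ) := by exact_mod_cast Nat.choose_pos (Nat.le_add_right p 6)
  have hUq : (Matroid.topCount M p 6 : ℚ) ≤ (n.choose 6 : ℚ) * 2 ^ 33 := by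
    have : (Matroid.topCount M p 6 : ℚ) ≤ ((n.choose 6 * 2 ^ (39 - 6) : ℕ) : ℚ) := by exact_mod_cast hU
    push_cast at this
    norm_num at this ⊢
    exact this
  have hU0 : (0 : ℚ) ≤ (Matroid.topCount M p 6 : ℚ) := by positivity
  have hYq : (n.choose (p - 1) : ℚ) ≤ (Matroid.midCount M p 6 : ℚ) +
      ({X : Set α | X ⊆ M.E ∧ M.eRk X ≤ 6}.ncard : ℚ) := by exact_mod_cast hY
  have hAq : ({X : Set α | X ⊆ M.E ∧ M.eRk X ≤ 6}.ncard : ℚ) ≤ 7700 * (n.choose 6 : ℚ) * 2 ^ 33 := by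
    exact_mod_cast hA'
  have hkeyq : ((2 : ℚ) ^ (p + 6) + 7700 * ((p + 6).choose p : ℚ)) * 2 ^ 33 * (n.choose 6 : ℚ) ≤
      ((p + 6).choose p : ℚ) * (n.choose (p - 1) : ℚ) := by exact_mod_cast hkey
  have hΦ0 : (0 : ℚ) ≤ (2 ^ (p + 6) : ℚ) / ((p + 6).choose p : ℚ) := by positivity
  calc phiK p 6 * (Matroid.topCount M p 6 : ℚ)
      ≤ ((2 ^ (p + 6) : ℚ) / ((p + 6).choose p : ℚ)) * ((n.choose 6 : ℚ) * 2 ^ 33) :=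
        mul_le_mul hΦ hUq hU0 hΦ0
    _ = ((2 : ℚ) ^ (p + 6) * 2 ^ 33 * (n.choose 6 : ℚ)) / ((p + 6).choose p : ℚ) := by ring
    _ ≤ (n.choose (p - 1) : ℚ) - 7700 * (n.choose 6 : ℚ) * 2 ^ 33 := by
        rw [div_le_iff₀ hc]
        nlinarith [hkeyq]
    _ ≤ (Matroid.midCount M p 6 : ℚ) := by linarith

/-- The key with the subtracted term at `p = 36`, `n = 88` — one numeral, decided. -/
theorem key_six_sub_36_88' :
    (2 ^ 42 + 7700 * Nat.choose 42 36) * 2 ^ 33 * Nat.choose 88 6 ≤ Nat.choose 42 36 * Nat.choose 88 35 := by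
  decide

/-- **The `e`-free core at level `6`, every corank `≥ 52`, every rank `p ≥ 36`** (`p ≥ 37`: the parent module;
`p = 36`: the key decided at `n₀ = 88 = p + 52 ≤ |E|`). -/
theorem c025_core_six_thirtynine_thirtysix' (M : Matroid α) [M.Finite] (p : ℕ) (hp : 36 ≤ p)
    (hR : M.eRank = (p : ℕ∞)) (hbig : p + 51 < M.E.ncard)
    (hfree : ∀ e ∈ M.E, ∃ A ⊆ M.E \ {e}, e ∉ M.closure A ∧ e ∉ M.closure ((M.E \ {e}) \ A)) : RLS M p 6 := by
  rcases Nat.lt_or_ge p 37 with hlt | hge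
  · have hp36 : p = 36 := by omega
    subst hp36
    refine core_six_corank_of_key_sub'' 88 le_rfl M 36 (by norm_num) ?_ (by omega) hfree
    have hk := key_of_base' 36 6 ((2 ^ 42 + 7700 * Nat.choose 42 36) * 2 ^ 33) (Nat.choose 42 36) 88
      (by norm_num) (by norm_num) (by norm_num) key_six_sub_36_88'
    intro n hn
    have := hk n hn
    simpa using this
  · exact c025_core_six_thirtynine_thirtyseven' M p hge hR hbig hfree

end ThmN

end PercRepro
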